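import Mathlib.Algebra.QuadraticAlgebra.Basic
import Literature.NumberTheory.QuadraticForms.GlobalSquareTheorem
import Literature.NumberTheory.QuadraticForms.QuadraticExtensionPlaces
import Literature.NumberTheory.GaloisRepresentations.FrobeniusDensityTheorem
import HarnessLib

/-!
# The Global Square Theorem (O'Meara 65:15) holds, by the density of split primes

Sibling proof file of `Literature.NumberTheory.QuadraticForms.GlobalSquareTheorem` (namespace
`Literature.NumberTheory.QuadraticForms`), all declarations fully proved. The named fact
`globalSquareTheorem K` (O'Meara, *Introduction to quadratic forms*, §65C Thm. 65:15: an element of a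
number field which is a square at almost all places is a square) is proved there *relative to* the
first inequality 65:14 (`globalSquareTheorem_of_two_le_normIdeles_index`), following O'Meara. Here it
is **discharged unconditionally** (`globalSquareTheorem_holds`) by the analytic route which the
tree already has in proved form: for a non-square `a ∈ K` the quadratic extension `E = K(√a)`
(Mathlib's `QuadraticAlgebra K a 0`, a number field, Galois of degree `2`) has its completely split
primes of strong Dirichlet density `1/2`
(`Literature.NumberTheory.GaloisRepresentations.hasStrongDirichletDensity_splitPrimes`, Marcus,
*Number Fields*, Ch. 7 Thm. 43, from the pole of `ζ_E` at `s = 1`), so the primes of `K` that do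
*not* split completely in `E` have density `1 - 1/2 > 0` and are infinite in number; an unramified
such prime has a single prime of `E` above it, which by the decomposition law of
`QuadraticExtensionPlaces.lean` (`ncard_finitePlacesOver_eq_two_of_isSquare`: two places above `v`
when `a ∈ K_v²`) means that `a` is not a square in `K_v`:

* `Literature.NumberTheory.LFunctions.HasStrongDirichletDensity.compl` — the complement of a set of
  primes of strong Dirichlet density `c` has strong Dirichlet density `1 - c`;
* `infinite_setOf_not_isSquare_adicCompletion` — **a non-square of `K` is a non-square in `K_v`
  for infinitely many finite places `v`** (the contrapositive, "infinitely many" form of 65:15 used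
  in O'Meara's proofs of 65:17 and 65:19; previously available only under 65:14 as
  `infinite_setOf_not_isSquare_of_two_le_normIdeles_index`);
* `globalSquareTheorem_holds : globalSquareTheorem K`.

## References

* O. T. O'Meara, *Introduction to quadratic forms*, Grundlehren 117, Springer (1963), §65C
  Thm. 65:15 (PDF p. 186 of the held copy), §65A (decomposition of `𝔭` in `E = F(√θ)`, p. 179).
* D. A. Marcus, *Number Fields*, 2nd ed., Springer (2018), Ch. 7, Thm. 43 (split primes have
  density `1/[L:K]`) and Cor. (a non-trivial extension has infinitely many non-split primes).
-/

noncomputable section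

open NumberField IsDedekindDomain

/-- **The complement of a set of primes of strong Dirichlet density `c` has strong Dirichlet
density `1 - c`** (`1_{Xᶜ} = 1_{univ} - 1_X`, all primes having density `1`,
`hasStrongDirichletDensity_univ`; linearity `hasStrongDirichletDensity_of_forall_indicator_eq`).
Declared by its absolute name as a dot-notation extension of
`Literature.NumberTheory.LFunctions.HasStrongDirichletDensity` (`LFunctions/PrimeLogDensity.lean`).
[folklore] -/
theorem _root_.Literature.NumberTheory.LFunctions.HasStrongDirichletDensity.compl
    {M : Type*} [Field M] [NumberField M] {X : Set (HeightOneSpectrum (𝓞 M))} {c : ℝ}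
    (h : Literature.NumberTheory.LFunctions.HasStrongDirichletDensity M X c) :
    Literature.NumberTheory.LFunctions.HasStrongDirichletDensity M Xᶜ (1 - c) := by
  classical
  set Xs : Bool → Set (HeightOneSpectrum (𝓞 M)) := fun b ↦ if b then Set.univ else X with hXs
  set cs : Bool → ℝ := fun b ↦ if b then 1 else c with hcs
  set a : Bool → ℝ := fun b ↦ if b then 1 else -1 with ha
  have hX : ∀ b ∈ (Finset.univ : Finset Bool),
      Literature.NumberTheory.LFunctions.HasStrongDirichletDensity M (Xs b) (cs b) := by
    rintro (_ | _) -
    · simpa [hXs, hcs] using h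
    · simpa [hXs, hcs] using Literature.NumberTheory.LFunctions.hasStrongDirichletDensity_univ M
  have heq : ∀ q ∉ (∅ : Set (HeightOneSpectrum (𝓞 M))), Xᶜ.indicator (fun _ ↦ (1 : ℝ)) q =
      ∑ b ∈ (Finset.univ : Finset Bool), a b * (Xs b).indicator (fun _ ↦ (1 : ℝ)) q := by
    intro q _
    rw [Finset.sum_eq_add_of_mem (a := true) (b := false) (Finset.mem_univ _) (Finset.mem_univ _)
      (by decide) (by rintro (_ | _) - h <;> simp at h)]
    by_cases hq : q ∈ X
    · have hqc : q ∉ Xᶜ := fun h' ↦ h' hq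
      simp [hXs, ha, hq, hqc]
    · have hqc : q ∈ Xᶜ := hq
      simp [hXs, ha, hq, hqc]
  have hd := Literature.NumberTheory.LFunctions.hasStrongDirichletDensity_of_forall_indicator_eq
    (Finset.univ : Finset Bool) a hX Set.finite_empty heq
  rw [Finset.sum_eq_add_of_mem (a := true) (b := false) (Finset.mem_univ _) (Finset.mem_univ _)
      (by decide) (by rintro (_ | _) - h <;> simp at h)] at hd
  simp only [ha, hcs, if_true] at hd
  convert hd using 1
  simp; ring

namespace Literature.NumberTheory.QuadraticForms

variable (K : Type*) [Field K] [NumberField K]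

variable {K} in
/-- **A non-square of a number field is a local non-square at infinitely many places** (the
"infinitely many" form of the Global Square Theorem, O'Meara 65:15, as used in the proofs of
65:17 and 65:19): if `a ∈ K` is not a square then `a` is not a square in `K_v` for infinitely many
finite places `v`. Proof (unconditional, analytic): in the quadratic extension `E = K(√a)`
(`QuadraticAlgebra K a 0`) the completely split primes have strong Dirichlet density `1/2`
(`hasStrongDirichletDensity_splitPrimes`, Marcus Ch. 7 Thm. 43), so the non-split primes have
density `1/2` (`HasStrongDirichletDensity.compl`) and are infinitely many; discarding the finitely
many ramified ones (`finite_setOf_not_isUnramifiedIn`), a non-split unramified prime `v` carries a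
prime of `E` of residue degree `2`, so it has only one prime of `E` above it
(`Σ e f = 2`, Mathlib `Ideal.ncard_primesOver_mul_ramificationIdxIn_mul_inertiaDegIn`), whereas
`a ∈ K_v²` would give two (`QuadraticExtension.ncard_finitePlacesOver_eq_two_of_isSquare`).
[cite: Omeara1963, §65C Thm. 65:15] -/
theorem infinite_setOf_not_isSquare_adicCompletion {a : K} (ha : ¬ IsSquare a) :
    {v : HeightOneSpectrum (𝓞 K) | ¬ IsSquare (algebraMap K (v.adicCompletion K) a)}.Infinite := by
  classical
  haveI hfact : Fact (∀ r : K, r ^ 2 ≠ a + 0 * r) :=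
    ⟨fun r h ↦ ha ⟨r, by rw [zero_mul, add_zero] at h; rw [← h, sq]⟩⟩
  let E := QuadraticAlgebra K a 0
  haveI hqe : Algebra.IsQuadraticExtension K E := { finrank_eq_two' := QuadraticAlgebra.finrank_eq_two a 0 }
  haveI : NumberField E := NumberField.of_module_finite K E
  -- the generator `ω`, `ω² = a`, `ω ∉ K`
  have hω : (QuadraticAlgebra.omega : E) ^ 2 = algebraMap K E a := by
    rw [sq, QuadraticAlgebra.omega_mul_omega_eq_add, zero_smul, add_zero,
      Algebra.algebraMap_eq_smul_one]
  have hωK : ∀ r : K, algebraMap K E r ≠ QuadraticAlgebra.omega := fun r h ↦ by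
    have him := congrArg QuadraticAlgebra.im h
    rw [QuadraticAlgebra.algebraMap_im, QuadraticAlgebra.omega_im] at him
    exact zero_ne_one him
  -- the non-split primes have density `1/2`, hence are infinitely many
  have hsplit := GaloisRepresentations.hasStrongDirichletDensity_splitPrimes K E
  have hcompl := hsplit.compl
  rw [Algebra.IsQuadraticExtension.finrank_eq_two K E] at hcompl
  have hpos : (0 : ℝ) < 1 - 1 / (2 : ℕ) := by norm_num
  have hinf : (GaloisRepresentations.splitPrimes K E)ᶜ.Infinite := hcompl.infinite hpos
  refine (hinf.sdiff (GaloisRepresentations.finite_setOf_not_isUnramifiedIn K E)).mono ?_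
  rintro v ⟨hv, hunr⟩ hsq
  simp only [Set.mem_setOf_eq, not_not] at hunr
  apply hv
  -- `a ∈ K_v²`: two places of `E` above `v`, so all primes above `v` have residue degree `1`
  have h2 : (finitePlacesOver E v).ncard = 2 :=
    QuadraticExtension.ncard_finitePlacesOver_eq_two_of_isSquare hω hωK v hsq
  rw [ncard_finitePlacesOver_eq_ncard_primesOver] at h2
  haveI : IsGaloisGroup (E ≃ₐ[K] E) (𝓞 K) (𝓞 E) := IsGaloisGroup.of_isFractionRing _ _ _ K E
  have hefg := Ideal.ncard_primesOver_mul_ramificationIdxIn_mul_inertiaDegIn v.asIdeal (𝓞 E)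
    (E ≃ₐ[K] E)
  rw [h2, IsGalois.card_aut_eq_finrank, Algebra.IsQuadraticExtension.finrank_eq_two K E] at hefg
  have hf : v.asIdeal.inertiaDegIn (𝓞 E) = 1 := by
    set x := v.asIdeal.ramificationIdxIn (𝓞 E) * v.asIdeal.inertiaDegIn (𝓞 E) with hx
    have hx1 : x = 1 := by omega
    exact Nat.eq_one_of_mul_eq_one_left hx1
  refine ⟨hunr, fun Q hQ ↦ ?_⟩
  haveI := hQ.1
  haveI := hQ.2
  rw [← Ideal.inertiaDegIn_eq_inertiaDeg v.asIdeal Q (E ≃ₐ[K] E)]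
  exact hf

/-- **The Global Square Theorem holds** (O'Meara, Thm. 65:15): the named fact
`globalSquareTheorem K` of `GlobalSquareTheorem.lean` — an element of the number field `K` which is
a square in `K_v` for all but finitely many finite places `v` is a square in `K` — discharged
unconditionally by `infinite_setOf_not_isSquare_adicCompletion` (density of split primes in
`K(√a)/K`), instead of O'Meara's route through the first inequality 65:14
(`globalSquareTheorem_of_two_le_normIdeles_index`). [cite: Omeara1963, §65C Thm. 65:15] -/
theorem globalSquareTheorem_holds (K : Type) [Field K] [NumberField K] : globalSquareTheorem K := by
  intro θ hθ
  by_contra hns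
  exact infinite_setOf_not_isSquare_adicCompletion hns (Filter.eventually_cofinite.1 hθ)

end Literature.NumberTheory.QuadraticForms
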